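import Mathlib

/-!
# PF-persistence: the served-field bracket of the pole-free criterion (`PFLow` / `PFMid` / `PFUp`)

pub-rhpf CAND SEAT 7 (floating B), gap-class rows C7-I9…C7-I13 / C7-N3, harness ids `cand7-009…013`
(mechanism / rigidity campaign; **no RH claims**; this file is kernel-checked finite-dimensional
algebra, labelled PROVED; every number the cell quotes from the Weil observatory is DATA and lives in
`GAP-CLASSES.md`, not here).

## Setting
On one window the even Weil–Galerkin block is `Q = A₀ + 2 |c⟩⟨c|` with `A₀ = −(archBlock + primesBlock)`
and `c = polarVec` (`PfPersistencePolarRankOne.evenBlock_eq_poleFree_add_two_smul`).  In the eigenbasis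
`u₀, u₁, …` of `Q` (levels `ε 0 ≤ ε 1 ≤ …` — the observatory's `eigs_even`; vectors `u_even`, bulk
`vecs_even`) the POLE-FREE block is the diagonal-minus-rank-one matrix `A₀ = diag(ε) − β c cᵀ` with
`c k = ⟪c, u_k⟫` and `β = 2` (served as `β ⟪c,u₀⟫² = q_polar`; `β = 0` on the pole-free control `dh`).
Its quadratic form is `poleFreeForm ε c β`, and on an INDEX-ONE window (`ε 0 < 0 < ε 1`) the sign of
its second level `E₁(A₀)` is decided by the secular value `secularValue ε c = ∑ c_k² / ε_k = ⟪c, Q⁻¹c⟫`.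

## Content (all PROVED; the min–max reading in brackets is the textbook Courant–Fischer step, not formalised)
* `poleFreeForm_nonneg_on_hyperplane`: `0 ≤ β`, `ε 0 < 0 < ε (j+1)`, `β · secularValue ε c ≤ 1` ⟹ `A₀ ≥ 0`
  on the explicit hyperplane `(β c₀² − ε₀) v₀ + β c₀ ∑_{k≥1} c_k v_k = 0`  [⟹ `E₁(A₀) ≥ 0`].
* `poleFreeForm_neg_on_plane`: `0 ≤ β`, `ε 0 < 0 < ε 1`, `¬ PFUp` (i.e. `β (c₀²/ε₀ + c₁²/ε₁) > 1`) ⟹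
  `A₀ < 0` on the coordinate plane of `u₀, u₁` off the origin  [⟹ `E₁(A₀) < 0`].
* The served-field certificates `PFLow` (reads `u₀` only: `C₀ = c₀²`, `W ≥ ∑_{k≥1} c_k² = ‖c‖² − C₀`),
  `PFMid` (reads the levels/vectors of a finite set `S ∋ 0` and places the residual polar mass `R` at a
  lower bound `e'` of the remaining levels) and `PFUp` (reads `u₀, u₁`), with the chain
  `PFLow → β·secularValue ≤ 1` (`secular_le_one_of_pfLow`), `PFMid → β·secularValue ≤ 1`
  (`secular_le_one_of_pfMid`), `β·secularValue ≤ 1 → PFUp` (`pfUp_of_secular_le_one`).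
  Hence per window `PFLow ⇒ PFMid ⇒ [E₁(A₀) ≥ 0] ⇒ PFUp`: the exact (unserved) leaf-G1.08 criterion
  `K_pf = [E₁(A₀) ≥ 0]` is DECIDED on a served window iff `PFMid ∨ ¬PFUp`.
* On windows with `ε 0 < 0 < ε 1` the harness's `PFLOW := [E_low ≥ 0]` (`E_low` = upper eigenvalue of
  `diag(ε₀, ε₁) − β w wᵀ`, `w = (√C₀, √W)`) is the inequality `PFLow` below (its margin column is
  `lg(τ_low/|ε₀|)` with `τ_low = β ε₁ C₀ /(β W − ε₁)`), and likewise for `PFUP` / `PFMID`.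
-/

namespace Summit.RiemannHypothesis.RiemannHypothesis.Theorems.PfPersistence.PoleFreeBracket

open Finset

variable {n : ℕ}

/-- Secular value `⟪c, Q⁻¹ c⟫ = ∑ c_k² / ε_k` of the polar vector in the eigenbasis of `Q`. -/
noncomputable def secularValue (ε c : Fin (n + 1) → ℝ) : ℝ := ∑ k, c k ^ 2 / ε k

/-- Quadratic form of the pole-free block `A₀ = diag ε − β c cᵀ` (eigen-coordinates of `Q`). -/
def poleFreeForm (ε c : Fin (n + 1) → ℝ) (β : ℝ) (v : Fin (n + 1) → ℝ) : ℝ :=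
  ∑ k, ε k * v k ^ 2 - β * (∑ k, c k * v k) ^ 2

/-- `PFLow` (harness `cand7-009`): `β (C₀/ε₀ + W/ε₁) ≤ 1`, read on the ground vector alone
(`C₀ = ⟪c,u₀⟫²`, `W = ‖c‖² − C₀`, so `W/ε₁` over-estimates the whole positive tail); an elementary
inequality over served fields (a certificate, not a cited result). [folklore] -/
def PFLow (β ε₀ ε₁ C₀ W : ℝ) : Prop := β * (C₀ / ε₀ + W / ε₁) ≤ 1

/-- `PFUp` (harness `cand7-010`): `β (C₀/ε₀ + C₁/ε₁) ≤ 1`, read on `u₀, u₁` (drops the positive tail);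
an elementary inequality over served fields (a certificate, not a cited result). [folklore] -/
def PFUp (β ε₀ ε₁ C₀ C₁ : ℝ) : Prop := β * (C₀ / ε₀ + C₁ / ε₁) ≤ 1

/-- `PFMid` (harness `cand7-013`): the levels indexed by `S` are read exactly and the residual polar
mass `R (≥ ∑_{k ∉ S} c_k²)` is placed at a lower bound `e'` of the unread levels; an elementary inequality
over served fields (a certificate, not a cited result). [folklore] -/
noncomputable def PFMid (β : ℝ) (S : Finset (Fin (n + 1))) (ε c : Fin (n + 1) → ℝ) (R e' : ℝ) : Prop :=
  β * (∑ k ∈ S, c k ^ 2 / ε k + R / e') ≤ 1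

/-! ### The chain `PFLow → PFMid-type bound → β·secularValue ≤ 1 → PFUp` -/

/-- PROVED (tail placement): reading the levels in `S` exactly and placing the rest of the polar mass at a
lower bound `e' > 0` of the unread levels over-estimates the secular value. -/
theorem secularValue_le_of_tail (S : Finset (Fin (n + 1))) {ε c : Fin (n + 1) → ℝ} {R e' : ℝ}
    (he' : 0 < e') (htail : ∀ k ∉ S, e' ≤ ε k) (hR : ∑ k ∈ Sᶜ, c k ^ 2 ≤ R) :
    secularValue ε c ≤ ∑ k ∈ S, c k ^ 2 / ε k + R / e' := by
  unfold secularValue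
  rw [← Finset.sum_add_sum_compl S (fun k => c k ^ 2 / ε k)]
  have h1 : ∑ k ∈ Sᶜ, c k ^ 2 / ε k ≤ ∑ k ∈ Sᶜ, c k ^ 2 / e' := by
    refine Finset.sum_le_sum fun k hk => ?_
    have hk' : k ∉ S := Finset.mem_compl.mp hk
    exact div_le_div_of_nonneg_left (sq_nonneg _) he' (htail k hk')
  have h2 : ∑ k ∈ Sᶜ, c k ^ 2 / e' = (∑ k ∈ Sᶜ, c k ^ 2) / e' := by
    rw [Finset.sum_div]
  have h3 : (∑ k ∈ Sᶜ, c k ^ 2) / e' ≤ R / e' := div_le_div_of_nonneg_right hR he'.le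
  linarith

/-- PROVED: `PFMid ⟹ β · secularValue ≤ 1` (the certificate is SUFFICIENT for the secular inequality). -/
theorem secular_le_one_of_pfMid {β : ℝ} (hβ : 0 ≤ β) (S : Finset (Fin (n + 1)))
    {ε c : Fin (n + 1) → ℝ} {R e' : ℝ} (he' : 0 < e') (htail : ∀ k ∉ S, e' ≤ ε k)
    (hR : ∑ k ∈ Sᶜ, c k ^ 2 ≤ R) (h : PFMid β S ε c R e') : β * secularValue ε c ≤ 1 :=
  le_trans (mul_le_mul_of_nonneg_left (secularValue_le_of_tail S he' htail hR) hβ) h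

/-- PROVED: `PFLow ⟹ β · secularValue ≤ 1` (`PFLow` is `PFMid` with `S = {0}`: only `u₀` is read). -/
theorem secular_le_one_of_pfLow {β : ℝ} (hβ : 0 ≤ β) {ε c : Fin (n + 1) → ℝ} {W e₁ : ℝ}
    (he₁ : 0 < e₁) (htail : ∀ k ≠ (0 : Fin (n + 1)), e₁ ≤ ε k) (hW : ∑ k ∈ ({0} : Finset _)ᶜ, c k ^ 2 ≤ W)
    (h : PFLow β (ε 0) e₁ (c 0 ^ 2) W) : β * secularValue ε c ≤ 1 := by
  have htail' : ∀ k ∉ ({0} : Finset (Fin (n + 1))), e₁ ≤ ε k := fun k hk =>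
    htail k (by simpa using hk)
  have := secularValue_le_of_tail {0} he₁ htail' hW
  simp only [Finset.sum_singleton] at this
  exact le_trans (mul_le_mul_of_nonneg_left this hβ) h

/-- PROVED: `β · secularValue ≤ 1 ⟹ PFUp` (the two-level reading is NECESSARY), for windows all of whose
levels above the second are positive. -/
theorem pfUp_of_secular_le_one {m : ℕ} {β : ℝ} (hβ : 0 ≤ β) {ε c : Fin (m + 2) → ℝ}
    (hpos : ∀ k : Fin (m + 2), k ≠ 0 → k ≠ 1 → 0 < ε k) (h : β * secularValue ε c ≤ 1) :
    PFUp β (ε 0) (ε 1) (c 0 ^ 2) (c 1 ^ 2) := by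
  unfold PFUp
  have hle : c 0 ^ 2 / ε 0 + c 1 ^ 2 / ε 1 ≤ secularValue ε c := by
    unfold secularValue
    rw [Fin.sum_univ_succ, Fin.sum_univ_succ]
    have : 0 ≤ ∑ k : Fin m, c k.succ.succ ^ 2 / ε k.succ.succ :=
      Finset.sum_nonneg fun k _ => div_nonneg (sq_nonneg _)
        (hpos _ (Fin.succ_ne_zero _) (by simp [Fin.ext_iff])).le
    simpa using this
  exact le_trans (mul_le_mul_of_nonneg_left hle hβ) h

/-! ### What the secular inequality certifies about `A₀` -/

/-- PROVED (lower certificate ⟹ a non-negative hyperplane).  If `β ⟪c, Q⁻¹c⟫ ≤ 1` on an index-one window,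
the pole-free form is `≥ 0` on the hyperplane `(β c₀² − ε₀) v₀ + β c₀ · ∑_{k ≥ 1} c_k v_k = 0`; by the
Courant–Fischer principle the second level of `A₀` is then `≥ 0`.  Proof: Cauchy–Schwarz in the weights
`ε_k > 0 (k ≥ 1)` plus the identity `D² · form = D (D S − β |ε₀| P²)` on the hyperplane,
`D = β c₀² − ε₀`, `S = ∑_{k≥1} ε_k v_k²`, `P = ∑_{k≥1} c_k v_k`. -/
theorem poleFreeForm_nonneg_on_hyperplane {β : ℝ} (hβ : 0 ≤ β) {ε c : Fin (n + 1) → ℝ}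
    (h0 : ε 0 < 0) (hpos : ∀ j : Fin n, 0 < ε j.succ) (hsec : β * secularValue ε c ≤ 1)
    (v : Fin (n + 1) → ℝ)
    (hv : (β * c 0 ^ 2 - ε 0) * v 0 + β * c 0 * ∑ j : Fin n, c j.succ * v j.succ = 0) :
    0 ≤ poleFreeForm ε c β v := by
  -- abbreviations
  set P : ℝ := ∑ j : Fin n, c j.succ * v j.succ with hP
  set S : ℝ := ∑ j : Fin n, ε j.succ * v j.succ ^ 2 with hS
  set G : ℝ := ∑ j : Fin n, c j.succ ^ 2 / ε j.succ with hG
  set D : ℝ := β * c 0 ^ 2 - ε 0 with hD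
  have hDpos : 0 < D := by
    have : 0 ≤ β * c 0 ^ 2 := mul_nonneg hβ (sq_nonneg _)
    linarith
  -- the form, split at the ground index
  have hform : poleFreeForm ε c β v = ε 0 * v 0 ^ 2 + S - β * (c 0 * v 0 + P) ^ 2 := by
    unfold poleFreeForm
    rw [Fin.sum_univ_succ, Fin.sum_univ_succ]
  -- the secular value, split at the ground index
  have hsecv : secularValue ε c = c 0 ^ 2 / ε 0 + G := by
    unfold secularValue; rw [Fin.sum_univ_succ]
  -- Cauchy–Schwarz with weights ε_j > 0 :  P² ≤ G · S
  have hCS : P ^ 2 ≤ G * S := by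
    have h := Finset.sum_mul_sq_le_sq_mul_sq Finset.univ
      (fun j : Fin n => c j.succ / Real.sqrt (ε j.succ)) (fun j : Fin n => Real.sqrt (ε j.succ) * v j.succ)
    have e1 : ∀ j : Fin n, c j.succ / Real.sqrt (ε j.succ) * (Real.sqrt (ε j.succ) * v j.succ) =
        c j.succ * v j.succ := fun j => by
      have hs : Real.sqrt (ε j.succ) ≠ 0 := (Real.sqrt_pos.mpr (hpos j)).ne'
      field_simp
    have e2 : ∀ j : Fin n, (c j.succ / Real.sqrt (ε j.succ)) ^ 2 = c j.succ ^ 2 / ε j.succ := fun j => by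
      rw [div_pow, Real.sq_sqrt (hpos j).le]
    have e3 : ∀ j : Fin n, (Real.sqrt (ε j.succ) * v j.succ) ^ 2 = ε j.succ * v j.succ ^ 2 := fun j => by
      rw [mul_pow, Real.sq_sqrt (hpos j).le]
    simp only [e1, e2, e3] at h
    simpa [hP, hG, hS] using h
  have hSnn : 0 ≤ S := Finset.sum_nonneg fun j _ => mul_nonneg (hpos j).le (sq_nonneg _)
  have hGnn : 0 ≤ G := Finset.sum_nonneg fun j _ => div_nonneg (sq_nonneg _) (hpos j).le
  -- from the secular inequality:  β |ε₀| G ≤ D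
  have ht : ε 0 * (c 0 ^ 2 / ε 0) = c 0 ^ 2 := by
    rw [← mul_div_assoc, mul_div_cancel_left₀ _ h0.ne]
  have hsec' : (-ε 0) * (β * (c 0 ^ 2 / ε 0 + G)) ≤ (-ε 0) * 1 :=
    mul_le_mul_of_nonneg_left (by rw [← hsecv]; exact hsec) (by linarith)
  have hkey : β * (-ε 0) * G ≤ D := by
    have : (-ε 0) * (β * (c 0 ^ 2 / ε 0 + G)) = -(β * (ε 0 * (c 0 ^ 2 / ε 0))) + β * (-ε 0) * G := by ring
    rw [this, ht] at hsec'
    linarith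
  -- hence  β |ε₀| P² ≤ D S
  have hmain : β * (-ε 0) * P ^ 2 ≤ D * S := by
    have hβa : 0 ≤ β * (-ε 0) := mul_nonneg hβ (by linarith)
    calc β * (-ε 0) * P ^ 2 ≤ β * (-ε 0) * (G * S) := mul_le_mul_of_nonneg_left hCS hβa
      _ = (β * (-ε 0) * G) * S := by ring
      _ ≤ D * S := mul_le_mul_of_nonneg_right hkey hSnn
  -- the polynomial identity on the hyperplane
  have hv' : D * v 0 + β * c 0 * P = 0 := by rw [hD]; linarith [hv]
  have hid : D ^ 2 * poleFreeForm ε c β v = D * (D * S - β * (-ε 0) * P ^ 2) := by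
    rw [hform]
    linear_combination (-(D) * (D * v 0 + β * c 0 * P) + 0 * v 0) * hv'
  have hnn : 0 ≤ D ^ 2 * poleFreeForm ε c β v := by
    rw [hid]; exact mul_nonneg hDpos.le (by linarith)
  exact (mul_nonneg_iff_of_pos_left (pow_pos hDpos 2)).mp hnn

/-- PROVED (`PFLow` certifies): the served-field lower certificate gives a non-negative hyperplane for `A₀`
[hence `E₁(A₀) ≥ 0` by Courant–Fischer]. -/
theorem pfLow_certifies {β : ℝ} (hβ : 0 ≤ β) {ε c : Fin (n + 1) → ℝ} {W : ℝ}
    (h0 : ε 0 < 0) (h1 : ∀ j : Fin n, 0 < ε j.succ) {e₁ : ℝ} (he₁ : 0 < e₁)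
    (htail : ∀ k ≠ (0 : Fin (n + 1)), e₁ ≤ ε k) (hW : ∑ k ∈ ({0} : Finset _)ᶜ, c k ^ 2 ≤ W)
    (h : PFLow β (ε 0) e₁ (c 0 ^ 2) W) (v : Fin (n + 1) → ℝ)
    (hv : (β * c 0 ^ 2 - ε 0) * v 0 + β * c 0 * ∑ j : Fin n, c j.succ * v j.succ = 0) :
    0 ≤ poleFreeForm ε c β v :=
  poleFreeForm_nonneg_on_hyperplane hβ h0 h1 (secular_le_one_of_pfLow hβ he₁ htail hW h) v hv

/-- The coordinate 2-plane of the two lowest eigenvectors `u₀, u₁`. -/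
def planeVec {m : ℕ} (x y : ℝ) : Fin (m + 2) → ℝ := fun k => if k = 0 then x else if k = 1 then y else 0

/-- The pole-free form restricted to the plane of `u₀, u₁` is the binary form
`ε₀ x² + ε₁ y² − β (c₀ x + c₁ y)²`. -/
theorem poleFreeForm_planeVec {m : ℕ} (ε c : Fin (m + 2) → ℝ) (β x y : ℝ) :
    poleFreeForm ε c β (planeVec x y) = ε 0 * x ^ 2 + ε 1 * y ^ 2 - β * (c 0 * x + c 1 * y) ^ 2 := by
  unfold poleFreeForm planeVec
  rw [Fin.sum_univ_succ, Fin.sum_univ_succ, Fin.sum_univ_succ, Fin.sum_univ_succ]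
  have h2 : ∀ k : Fin m, ((k.succ.succ : Fin (m + 2)) = 0) = False := fun k => by
    simp [Fin.ext_iff]
  have h3 : ∀ k : Fin m, ((k.succ.succ : Fin (m + 2)) = 1) = False := fun k => by
    simp [Fin.ext_iff]
  simp [h2, h3]

/-- PROVED (failed upper certificate ⟹ a negative plane).  If `PFUp` FAILS on an index-one window, the
pole-free form is `< 0` on the plane of `u₀, u₁` off the origin; by min–max the second level of `A₀` is
then `< 0` (a certified negative pole-free level).  Proof: with `A = ε₀ − β c₀² < 0`,
`A · form = (A x − β c₀ c₁ y)² + K y²`, `K = ε₀ε₁ − β(c₀²ε₁ + c₁²ε₀) > 0`. -/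
theorem poleFreeForm_neg_on_plane {m : ℕ} {β : ℝ} (hβ : 0 ≤ β) {ε c : Fin (m + 2) → ℝ}
    (h0 : ε 0 < 0) (h1 : 0 < ε 1) (hfail : ¬ PFUp β (ε 0) (ε 1) (c 0 ^ 2) (c 1 ^ 2))
    {x y : ℝ} (hxy : x ≠ 0 ∨ y ≠ 0) : poleFreeForm ε c β (planeVec x y) < 0 := by
  rw [poleFreeForm_planeVec]
  unfold PFUp at hfail
  push Not at hfail
  -- K > 0 from the failed certificate
  have ht0 : ε 0 * (c 0 ^ 2 / ε 0) = c 0 ^ 2 := by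
    rw [← mul_div_assoc, mul_div_cancel_left₀ _ h0.ne]
  have ht1 : ε 1 * (c 1 ^ 2 / ε 1) = c 1 ^ 2 := by
    rw [← mul_div_assoc, mul_div_cancel_left₀ _ h1.ne']
  have hneg : ε 0 * ε 1 < 0 := mul_neg_of_neg_of_pos h0 h1
  have hK : 0 < ε 0 * ε 1 - β * (c 0 ^ 2 * ε 1 + c 1 ^ 2 * ε 0) := by
    have := mul_lt_mul_of_neg_left hfail hneg
    have e : ε 0 * ε 1 * (β * (c 0 ^ 2 / ε 0 + c 1 ^ 2 / ε 1)) =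
        β * (ε 1 * (ε 0 * (c 0 ^ 2 / ε 0)) + ε 0 * (ε 1 * (c 1 ^ 2 / ε 1))) := by ring
    rw [e, ht0, ht1] at this
    linarith
  have hA : ε 0 - β * c 0 ^ 2 < 0 := by
    have : 0 ≤ β * c 0 ^ 2 := mul_nonneg hβ (sq_nonneg _)
    linarith
  have hid : (ε 0 - β * c 0 ^ 2) * (ε 0 * x ^ 2 + ε 1 * y ^ 2 - β * (c 0 * x + c 1 * y) ^ 2) =
      ((ε 0 - β * c 0 ^ 2) * x - β * c 0 * c 1 * y) ^ 2 +
        (ε 0 * ε 1 - β * (c 0 ^ 2 * ε 1 + c 1 ^ 2 * ε 0)) * y ^ 2 := by ring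
  have hpos : 0 < ((ε 0 - β * c 0 ^ 2) * x - β * c 0 * c 1 * y) ^ 2 +
      (ε 0 * ε 1 - β * (c 0 ^ 2 * ε 1 + c 1 ^ 2 * ε 0)) * y ^ 2 := by
    by_cases hy : y = 0
    · subst hy
      have hx : x ≠ 0 := by
        rcases hxy with hx | hy'
        · exact hx
        · exact absurd rfl hy'
      have : (ε 0 - β * c 0 ^ 2) * x ≠ 0 := mul_ne_zero hA.ne hx
      simpa using sq_pos_iff.mpr this
    · exact add_pos_of_nonneg_of_pos (sq_nonneg _) (mul_pos hK (by positivity))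
  rw [← hid] at hpos
  exact neg_of_mul_pos_right hpos hA.le

end Summit.RiemannHypothesis.RiemannHypothesis.Theorems.PfPersistence.PoleFreeBracket
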